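import Summits.ValiantsHypothesis.ValiantsHypothesis.Theorems.LacunarySymmetroidMatrixDescartesVSQGenDefs
import Summits.ValiantsHypothesis.ValiantsHypothesis.Theorems.LacunarySymmetroidMatrixDescartesVSQTriKit
import Literature.Analysis.Matrix.TridiagonalDeterminant

/-!
# `MatrixDescartes` census — the recursive tridiagonal family: symmetry, tridiagonality and the CONTINUANT RECURRENCE

HONEST FRAMING.  Val-V1-extremal engine seat val-v1x-eng-6 (g2), `--supports stmt-ValiantsHypothesis-18050` (helper).  Structural facts
about `genL / GM / fL` of `…VSQGenDefs`: every letter is symmetric (`genL_isSymm`) and tridiagonal (`genL_tri`); the trailing block of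
`GM (L+2) t` is `(−1)^n · GM (L+1) (t/B^σ)` (`GM_submatrix_succ`); hence, by the continuant recurrence of
`Literature.Analysis.Matrix.det_tridiagonal_eq` (Horn–Johnson §0.9.10),
`fL (L+2) t = a(t) · ((−1)^n)^{L+1} · fL (L+1) (t/B^σ) − (B^{−δ} b(t))² · fL L (t/B^{2σ})` (`fL_rec`), with `fL 0 = 1` and
`fL 1 t = (−1)^n B^{−2δ} c(t)`.  Nothing here bears on the crux `MatrixDescartes` (stmt-18050) or on `VP ≠ VNP`.
[folklore] Continuants; elementary.
-/

set_option linter.dupNamespace false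
set_option autoImplicit false

namespace Summit.ValiantsHypothesis.ValiantsHypothesis.Theorems.LacunarySymmetroidMatrixDescartes.VSQ

open scoped BigOperators
open Finset

variable {n : ℕ} {B : ℝ}

/-! ## 1. Entries -/

/-- entry formulas of `genL (L+2)`. [folklore] -/
theorem genL_ss_apply (n : ℕ) (B : ℝ) (L : ℕ) (l : Fin (n + 2)) :
    genL n B (L + 2) l 0 0 = saF n l * B ^ haF n l ∧
    (∀ j' : Fin (L + 1), genL n B (L + 2) l 0 j'.succ = if (j' : ℕ) = 0 then sbF n l * B ^ (hbF n l - (dlt n : ℤ)) else 0) ∧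
    (∀ i' : Fin (L + 1), genL n B (L + 2) l i'.succ 0 = if (i' : ℕ) = 0 then sbF n l * B ^ (hbF n l - (dlt n : ℤ)) else 0) ∧
    (∀ i' j' : Fin (L + 1), genL n B (L + 2) l i'.succ j'.succ =
      (-1) ^ n * B ^ (-((sg n : ℤ) * (dF n l : ℤ))) * genL n B (L + 1) l i' j') := by
  refine ⟨?_, fun j' => ?_, fun i' => ?_, fun i' j' => ?_⟩ <;> simp [genL]

/-- the letters are symmetric. [folklore] -/
theorem genL_isSymm (n : ℕ) (B : ℝ) : ∀ (L : ℕ) (l : Fin (n + 2)), (genL n B L l).IsSymm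
  | 0, l => by ext i j; exact i.elim0
  | 1, l => by ext i j; simp [genL, Matrix.transpose_apply]
  | L + 2, l => by
    obtain ⟨h00, h0s, hs0, hss⟩ := genL_ss_apply n B L l
    have ih := genL_isSymm n B (L + 1) l
    ext i j
    rw [Matrix.transpose_apply]
    refine Fin.cases ?_ (fun i' => ?_) i <;> refine Fin.cases ?_ (fun j' => ?_) j
    · rfl
    · rw [h0s, hs0]
    · rw [hs0, h0s]
    · rw [hss, hss, ih.apply i' j']

/-- the letters are tridiagonal. [folklore] -/
theorem genL_tri (n : ℕ) (B : ℝ) : ∀ (L : ℕ) (l : Fin (n + 2)) (i j : Fin L),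
    (i : ℕ) + 1 < j ∨ (j : ℕ) + 1 < i → genL n B L l i j = 0
  | 0, l, i, j, _ => i.elim0
  | 1, l, i, j, h => by have := i.isLt; have := j.isLt; omega
  | L + 2, l, i, j, h => by
    obtain ⟨h00, h0s, hs0, hss⟩ := genL_ss_apply n B L l
    revert h
    refine Fin.cases ?_ (fun i' => ?_) i <;> refine Fin.cases ?_ (fun j' => ?_) j <;> intro h
    · simp at h
    · rw [h0s, if_neg (by simp only [Fin.val_zero, Fin.val_succ] at h; omega)]
    · rw [hs0, if_neg (by simp only [Fin.val_zero, Fin.val_succ] at h; omega)]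
    · rw [hss, genL_tri n B (L + 1) l i' j' (by simp only [Fin.val_succ] at h; omega), mul_zero]

/-- `GM` is tridiagonal. [folklore] -/
theorem GM_tri (n : ℕ) (B : ℝ) (L : ℕ) (t : ℝ) (i j : Fin L) (h : (i : ℕ) + 1 < j ∨ (j : ℕ) + 1 < i) :
    GM n B L t i j = 0 := by
  unfold GM
  rw [Matrix.sum_apply]
  exact Finset.sum_eq_zero fun l _ => by rw [Matrix.smul_apply, genL_tri n B L l i j h, smul_zero]

/-- the corner entries of `GM (L+2) t`: `a(t)`, `B^{−δ} b(t)`, `B^{−δ} b(t)`. [folklore] -/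
theorem GM_corner (hB0 : B ≠ 0) (L : ℕ) (t : ℝ) :
    GM n B (L + 2) t 0 0 = fa n B t ∧ GM n B (L + 2) t 0 1 = B ^ (-(dlt n : ℤ)) * fb n B t ∧
    GM n B (L + 2) t 1 0 = B ^ (-(dlt n : ℤ)) * fb n B t := by
  have h := fun l => genL_ss_apply n B L l
  have e1 : B ^ (-(dlt n : ℤ)) * fb n B t = ∑ l, t ^ dF n l * (sbF n l * B ^ (hbF n l - (dlt n : ℤ))) := by
    unfold fb; rw [← bnom_hconst hB0]; unfold bnom tv; exact Finset.sum_congr rfl fun l _ => by ring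
  refine ⟨?_, ?_, ?_⟩
  · unfold GM fa bnom tv
    rw [Matrix.sum_apply]
    exact Finset.sum_congr rfl fun l _ => by rw [Matrix.smul_apply, (h l).1, smul_eq_mul]; ring
  · rw [e1]; unfold GM; rw [Matrix.sum_apply]
    exact Finset.sum_congr rfl fun l _ => by
      rw [Matrix.smul_apply, show (1 : Fin (L + 2)) = (0 : Fin (L + 1)).succ from rfl, (h l).2.1]; simp
  · rw [e1]; unfold GM; rw [Matrix.sum_apply]
    exact Finset.sum_congr rfl fun l _ => by
      rw [Matrix.smul_apply, show (1 : Fin (L + 2)) = (0 : Fin (L + 1)).succ from rfl, (h l).2.2.1]; simp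

/-- the trailing block of `GM (L+2) t` is `(−1)^n · GM (L+1) (t/B^σ)`. [folklore] -/
theorem GM_submatrix_succ (n : ℕ) (B : ℝ) (L : ℕ) (t : ℝ) :
    (GM n B (L + 2) t).submatrix Fin.succ Fin.succ = ((-1 : ℝ) ^ n) • GM n B (L + 1) (B ^ (-(sg n : ℤ)) * t) := by
  ext i' j'
  have h := fun l => (genL_ss_apply n B L l).2.2.2 i' j'
  unfold GM
  rw [Matrix.submatrix_apply, Matrix.sum_apply, Matrix.smul_apply, Matrix.sum_apply, smul_eq_mul, Finset.mul_sum]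
  refine Finset.sum_congr rfl fun l _ => ?_
  rw [Matrix.smul_apply, Matrix.smul_apply, h l, smul_eq_mul, smul_eq_mul, mul_pow, ← zpow_natCast (B ^ (-(sg n : ℤ))) (dF n l),
    ← zpow_mul, neg_mul]
  ring

/-- `fL 0 = 1`. [folklore] -/
theorem fL_zero (n : ℕ) (B t : ℝ) : fL n B 0 t = 1 := by
  unfold fL; exact Matrix.det_isEmpty

/-- `fL 1 t = (−1)^n B^{−2δ} c(t)`. [folklore] -/
theorem fL_one (hB0 : B ≠ 0) (t : ℝ) : fL n B 1 t = (-1) ^ n * (B ^ (-(2 * (dlt n : ℤ))) * fc n B t) := by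
  unfold fL GM
  rw [Matrix.det_unique, Matrix.sum_apply]
  unfold fc
  rw [← bnom_hconst hB0, ← bnom_smul]
  unfold bnom tv
  refine Finset.sum_congr rfl fun l _ => ?_
  rw [Matrix.smul_apply, smul_eq_mul]
  simp only [genL, Matrix.of_apply]
  ring

/-- **continuant recurrence**: `fL (L+2) t = a(t)·((−1)^n)^{L+1}·fL (L+1) (t/B^σ) − (B^{−δ} b(t))²·fL L (t/B^{2σ})`. [folklore] -/
theorem fL_rec (hB0 : B ≠ 0) (L : ℕ) (t : ℝ) :
    fL n B (L + 2) t = fa n B t * (((-1 : ℝ) ^ n) ^ (L + 1) * fL n B (L + 1) (B ^ (-(sg n : ℤ)) * t)) -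
      (B ^ (-(dlt n : ℤ)) * fb n B t) ^ 2 * fL n B L (B ^ (-(sg n : ℤ)) * (B ^ (-(sg n : ℤ)) * t)) := by
  obtain ⟨c00, c01, c10⟩ := GM_corner (n := n) hB0 L t
  unfold fL
  rw [Literature.Analysis.Matrix.det_tridiagonal_eq (GM n B (L + 2) t) (fun i j h => GM_tri n B (L + 2) t i j h), c00, c01, c10,
    ← Matrix.submatrix_submatrix, GM_submatrix_succ n B L t, Matrix.det_smul, Fintype.card_fin]
  congr 1
  · rw [sq]
    congr 1
    -- the second trailing block
    rcases L with _ | L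
    · -- `L = 0`: both are empty determinants
      rw [Matrix.det_isEmpty]; unfold GM; rw [Matrix.det_isEmpty]
    · have h2 : (GM n B (L + 1 + 1) (B ^ (-(sg n : ℤ)) * t)).submatrix Fin.succ Fin.succ =
          ((-1 : ℝ) ^ n) • GM n B (L + 1) (B ^ (-(sg n : ℤ)) * (B ^ (-(sg n : ℤ)) * t)) :=
        GM_submatrix_succ n B L (B ^ (-(sg n : ℤ)) * t)
      have h3 : (((-1 : ℝ) ^ n) • GM n B (L + 1 + 1) (B ^ (-(sg n : ℤ)) * t)).submatrix Fin.succ Fin.succ =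
          ((-1 : ℝ) ^ n) • ((GM n B (L + 1 + 1) (B ^ (-(sg n : ℤ)) * t)).submatrix Fin.succ Fin.succ) := rfl
      rw [h3, h2, smul_smul, ← sq, ← pow_mul, mul_comm n 2, pow_mul, Matrix.det_smul, Fintype.card_fin]
      norm_num

end Summit.ValiantsHypothesis.ValiantsHypothesis.Theorems.LacunarySymmetroidMatrixDescartes.VSQ
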